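import Mathlib.Data.Fintype.EquivFin
import Mathlib.Logic.Function.Basic
import HarnessLib

/-!
# Venture HSemireg — AT A COMMON POINT OF THREE PINNED TILES THE EXACT-LCI GADGET FORCES ALL 27 RECOMBINED TILES
(kernel form of `step0/B/ANATOMY-CASEA-s0-2.md` §5 (2), «layer 1 is forced»)

Setting (cell pub-hsemireg, door (I), encoder B = `c9xlazy.py` over t-6's `c9x.py`).  At an ambient point
`t = (t₀, t₁, t₂)` of `S³ = (E_ω²)³` the encoder adds the EXACT-LCI POINT GADGET `c9x.encode_point`: every
universe line `l` through `tᵢ` in slot `i` carries at most one of three labels (`lab i l : Option (Fin 3)`),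
and, reading its clause families semantically (`present f` = the curve triple with slot lines `f 0, f 1, f 2`
is in the configuration),

* (75)  `h75` : in no slot are all three labels in use;
* (80)  `h80` : two distinct lines of a slot carrying the same label exclude every other label in that slot;
* (93)  `h93` : if the slot lines of a curve triple carry pairwise distinct labels, the triple is present;
* (94)–(98)  `h94` : a present triple has its three slot lines labelled, with pairwise distinct labels.

(The padding clauses (99)–(120) at grid points are not needed below and are not assumed; nothing else about
the encoder is used.)

WHAT IS PROVED.  `all_recombinations_present`: if three triples `s 0, s 1, s 2` (think `X = Γ₁³@0`,
`Y1 = (L_ω@c)³`, `Y2 = (L_ω²@d)³` of a TRIPLE-PIN class) are present and pass through `t` with pairwise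
distinct lines in every slot, then EVERY one of the 27 recombined triples `(s (f 0) 0, s (f 1) 1, s (f 2) 2)`,
`f : Fin 3 → Fin 3`, is present.  Proof = the short argument of the ANATOMY note: by (94)–(98) each seed's
labels form a permutation; in a slot the three seed lines cannot carry three distinct labels (75), so two
agree and then (80) makes the slot monochromatic (`slot_monochromatic`); hence the label of a seed line
depends on the slot only, through ONE permutation (`common_permutation`), and (93) fires for every
recombination; `fullProduct_star_realises_gadget` records that the four hypotheses are jointly satisfiable
(non-vacuity).  For tri209 (all 27 points of `X ∩ Y1 ∩ Y2` off-grid, only the three seed lines through each)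
this is the statement «the 27 tiles are decided before a single (R1)(R2) partner is chosen»; the lemma itself
holds at any common point, on-grid or not, whatever further lines pass through it.

HONEST FRAMING.  Finite combinatorics of one clause gadget (labels in `Fin 3`); no SAT solver, no geometry;
that `encode_point` emits exactly these clause families is read off the code (t-6 `c9x.py` ll. 56–121), not
proved here.  Nothing here bears on HC ∕ HC_CM ∕ HC_AV.
-/

namespace Summit.Ventures.HSemireg
namespace TriplePointStar

variable {L : Type*} {lab : Fin 3 → L → Option (Fin 3)} {present : (Fin 3 → L) → Prop}

/-- In a slot through which three DISTINCT labelled lines pass, all three carry the same label: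
(75) forbids three distinct labels, (80) propagates a repeated one. -/
theorem slot_monochromatic
    (h75 : ∀ i, ¬ ((∃ l, lab i l = some 0) ∧ (∃ l, lab i l = some 1) ∧ (∃ l, lab i l = some 2)))
    (h80 : ∀ i (l l' : L) (a b : Fin 3), l ≠ l' → lab i l = some a → lab i l' = some a → a ≠ b →
      ∀ m, lab i m ≠ some b)
    (i : Fin 3) (m : Fin 3 → L) (hm : Function.Injective m) (φ : Fin 3 → Fin 3)
    (hφ : ∀ k, lab i (m k) = some (φ k)) : ∀ k k', φ k = φ k' := by
  classical
  by_cases hinj : Function.Injective φ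
  · -- three distinct labels in one slot: excluded by (75)
    exfalso
    have hsurj : Function.Surjective φ := Finite.surjective_of_injective hinj
    obtain ⟨k₀, h₀⟩ := hsurj 0
    obtain ⟨k₁, h₁⟩ := hsurj 1
    obtain ⟨k₂, h₂⟩ := hsurj 2
    exact h75 i ⟨⟨m k₀, h₀ ▸ hφ k₀⟩, ⟨m k₁, h₁ ▸ hφ k₁⟩, ⟨m k₂, h₂ ▸ hφ k₂⟩⟩
  · -- two lines share a label: (80) makes the slot monochromatic
    obtain ⟨k, k', hkk', hne⟩ := Function.not_injective_iff.mp hinj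
    have hall : ∀ j, φ j = φ k := by
      intro j
      by_contra hj
      exact h80 i (m k) (m k') (φ k) (φ j) (fun h => hne (hm h)) (hφ k) (hkk' ▸ hφ k')
        (fun h => hj h.symm) (m j) (hφ j)
    intro j j'
    rw [hall j, hall j']

/-- One permutation of the labels serves every seed: at a common point of three present triples with
pairwise distinct lines in each slot there is `c₀` (injective) with `lab i (s k i) = c₀ i` for all seeds `k`
— the «(3 lines) × (3 lines) × (3 lines) full-product star». -/
theorem common_permutation
    (h75 : ∀ i, ¬ ((∃ l, lab i l = some 0) ∧ (∃ l, lab i l = some 1) ∧ (∃ l, lab i l = some 2)))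
    (h80 : ∀ i (l l' : L) (a b : Fin 3), l ≠ l' → lab i l = some a → lab i l' = some a → a ≠ b →
      ∀ m, lab i m ≠ some b)
    (h94 : ∀ f, present f → ∃ c : Fin 3 → Fin 3, Function.Injective c ∧ ∀ i, lab i (f i) = some (c i))
    (s : Fin 3 → Fin 3 → L) (hinj : ∀ i, Function.Injective (fun k => s k i)) (hs : ∀ k, present (s k)) :
    ∃ c₀ : Fin 3 → Fin 3, Function.Injective c₀ ∧ ∀ i k, lab i (s k i) = some (c₀ i) := by
  choose c hc using fun k => h94 (s k) (hs k)
  refine ⟨c 0, (hc 0).1, fun i k => ?_⟩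
  rw [← slot_monochromatic h75 h80 i (fun k => s k i) (hinj i) (fun k => c k i) (fun k => (hc k).2 i) k 0]
  exact (hc k).2 i

/-- TRIPLE-POINT TILE FORCING.  Three present triples `s 0, s 1, s 2` through one point, with pairwise
distinct lines in each slot ⇒ all 27 recombinations `i ↦ s (f i) i` are present. -/
theorem all_recombinations_present
    (h75 : ∀ i, ¬ ((∃ l, lab i l = some 0) ∧ (∃ l, lab i l = some 1) ∧ (∃ l, lab i l = some 2)))
    (h80 : ∀ i (l l' : L) (a b : Fin 3), l ≠ l' → lab i l = some a → lab i l' = some a → a ≠ b →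
      ∀ m, lab i m ≠ some b)
    (h93 : ∀ (f : Fin 3 → L) (c : Fin 3 → Fin 3), (∀ i, lab i (f i) = some (c i)) →
      Function.Injective c → present f)
    (h94 : ∀ f, present f → ∃ c : Fin 3 → Fin 3, Function.Injective c ∧ ∀ i, lab i (f i) = some (c i))
    (s : Fin 3 → Fin 3 → L) (hinj : ∀ i, Function.Injective (fun k => s k i)) (hs : ∀ k, present (s k))
    (f : Fin 3 → Fin 3) : present (fun i => s (f i) i) := by
  obtain ⟨c₀, hc₀, hlab⟩ := common_permutation h75 h80 h94 s hinj hs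
  exact h93 _ c₀ (fun i => hlab i (f i)) hc₀

/-- The same with the point's further lines made explicit: ANY other labelled line `l` of slot `i` through
the point carries the common label `c₀ i` as well ((80) again), so every triple mixing it with seed lines of
the other two slots is present too — the star at the point is the full product of all labelled lines. -/
theorem extra_line_same_label
    (h75 : ∀ i, ¬ ((∃ l, lab i l = some 0) ∧ (∃ l, lab i l = some 1) ∧ (∃ l, lab i l = some 2)))
    (h80 : ∀ i (l l' : L) (a b : Fin 3), l ≠ l' → lab i l = some a → lab i l' = some a → a ≠ b →
      ∀ m, lab i m ≠ some b)
    (h94 : ∀ f, present f → ∃ c : Fin 3 → Fin 3, Function.Injective c ∧ ∀ i, lab i (f i) = some (c i))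
    (s : Fin 3 → Fin 3 → L) (hinj : ∀ i, Function.Injective (fun k => s k i)) (hs : ∀ k, present (s k))
    (i : Fin 3) (l : L) (a : Fin 3) (hl : lab i l = some a) :
    ∃ c₀ : Fin 3 → Fin 3, Function.Injective c₀ ∧ (∀ j k, lab j (s k j) = some (c₀ j)) ∧ a = c₀ i := by
  obtain ⟨c₀, hc₀, hlab⟩ := common_permutation h75 h80 h94 s hinj hs
  refine ⟨c₀, hc₀, hlab, ?_⟩
  by_contra ha
  have h01 : s 0 i ≠ s 1 i := fun h => absurd (hinj i h) (by decide)
  exact h80 i (s 0 i) (s 1 i) (c₀ i) a h01 (hlab i 0) (hlab i 1) (fun h => ha h.symm) l hl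

/-- NON-VACUITY of the hypotheses: the full-product star (every line of slot `i` carries the label `i`,
every triple is present) satisfies (75), (80), (93), (94)–(98) — so the lemma is not an artefact of
inconsistent premises. -/
theorem fullProduct_star_realises_gadget :
    ∃ (lab : Fin 3 → Fin 3 → Option (Fin 3)) (present : (Fin 3 → Fin 3) → Prop),
      (∀ i, ¬ ((∃ l, lab i l = some 0) ∧ (∃ l, lab i l = some 1) ∧ (∃ l, lab i l = some 2))) ∧
      (∀ i (l l' : Fin 3) (a b : Fin 3), l ≠ l' → lab i l = some a → lab i l' = some a → a ≠ b →
        ∀ m, lab i m ≠ some b) ∧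
      (∀ (f : Fin 3 → Fin 3) (c : Fin 3 → Fin 3), (∀ i, lab i (f i) = some (c i)) →
        Function.Injective c → present f) ∧
      (∀ f, present f → ∃ c : Fin 3 → Fin 3, Function.Injective c ∧ ∀ i, lab i (f i) = some (c i)) ∧
      (∀ f, present f) := by
  refine ⟨fun i _ => some i, fun _ => True, ?_, ?_, ?_, ?_, fun _ => trivial⟩
  · rintro i ⟨⟨_, h0⟩, ⟨_, h1⟩, -⟩
    simp only [Option.some.injEq] at h0 h1
    exact absurd (h0.symm.trans h1) (by decide)
  · intro i l l' a b _ ha _ hab m hm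
    simp only [Option.some.injEq] at ha hm
    exact hab (ha.symm.trans hm)
  · intro _ _ _ _; trivial
  · intro f _
    exact ⟨id, Function.injective_id, fun i => rfl⟩

end TriplePointStar
end Summit.Ventures.HSemireg
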